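import Literature.AnabelianGeometry.SemiGraphs.TemperedCurveOfOpenSubgroup
import Literature.AnabelianGeometry.EtaleTheta.SettingBridge
import Literature.AnabelianGeometry.EtaleTheta.SingleUnderline
import Mathlib.GroupTheory.DoubleCoset
import HarnessLib

/-!
# Points of a finite étale covering `X_H → X` over a point whose decomposition group lies in `H ⊴ Π^tp_X`: exactly `[Π^tp_X : H]` of them — the cusp of `X` SPLITS into `l` cusps of `X̲`

S. Mochizuki, *Semi-graphs of anabelioids*, Publ. RIMS **42** (2006) [SemiAnbd], §6 p. 71 (decomposition / inertia groups of the cusps of a tempered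
covering; the points of `X_H` over `x` are the double cosets `H \ Π^tp_X / D_x`) [cite: MochizukiSemiAnbd2006, §6 p.71]; S. Mochizuki, *The étale theta
function …*, Publ. RIMS **45** (2009) [EtTh], §1 p. 13 («decomposition groups of cusps lie in `Π^tp_Y`»), Def 2.5 (i) p. 39 (`X̲ → X`)
[cite: MochizukiEtTh2009, Def 2.5 (i) p.39]; used by [IUTchII] Def 2.3 (iii)/(v) (kurims p. 68: `LabCusp^±` has `l` elements) [cite: Mochizuki2012, II Def 2.3 (iii) p.68]
(claim key disputed; nothing of the series is asserted).  abc-iut cell, seat abc-iut-w5-d132 (gen 5); by-name groundwork for the input (ii) «`|LabCusp^±(Π̂^±_v)| = l`» of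
abc-iut-w5-d243's Def 2.3 (v) criterion (`FlTorsorStructureConj.nonempty_iff_conjStable_card_ker`, p440082) at abc-iut-L6-t7's `X̲_v = ofOpenSubgroup X (GtpXu l)`.
PROOF-ONLY (no `def`/`structure`/`instance`).

* `Subgroup.card_doubleCosetQuotient_of_le_normal` — plain group theory: for `K ≤ H ⊴ G`, the double coset space `H \ G / K` is the coset space `G/H`:
  `Nat.card (H \ G / K) = [G : H]` (every double coset `H g K` is the coset `H g`);
* `TemperedCurve.card_fibre_ptOfOpen_of_decomp_le` — for abc-iut-L6-t7's `X.PtOfOpen H` (points of `X_H` = `Σ x, H \ Π^tp_X / D_x`): the fibre over a point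
  `x` with `D_x ≤ H`, `H ⊴ Π^tp_X`, has exactly `[Π^tp_X : H]` elements («`x` splits completely»);
* **`ThetaSetting.card_cusps_over_eq_l`** — for the [EtTh] §1/§2 setting: over every cusp `x` of `X`, the covering `X̲ → X` (`Π^tp_{X̲} = GtpXu l = toZ⁻¹(l·Z)`,
  abc-iut-L2) has EXACTLY `l` points, given SettingBridge's parameter (P3) «`D_x ⊆ Π^tp_Y = Ker(toZ)`» (`decomp_le_ker_toZ`) — `Π^tp_Y ⊆ Π^tp_{X̲}` (`GtpY_le_GtpXu`)
  and `[Π^tp_X : Π^tp_{X̲}] = l` (`index_GtpXu`).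

HONEST LABEL: kernel theorems over the tree's typings; (P3) is a named parameter; the passage «`l` cusps of `X̲_v`» ⇒ «`|LabCusp^±(Π̂^±_v)| = l`» needs the cusp
SEPARATION input (inertia groups of distinct cusps are not conjugate in `Π̂`), NOT supplied here.  No side taken on [IUTchIII] Cor 3.12.
-/

/-! ### Group theory: `H \ G / K = G / H` when `K ≤ H ⊴ G` -/

namespace Subgroup

variable {G : Type*} [Group G]

/-- **`H \ G / K ≅ H \ G` for `K ≤ H ⊴ G`, at the level of cardinalities**: `Nat.card (DoubleCoset.Quotient H K) = [G : H]` — the double coset `H g K`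
equals the right coset `H g` (`g K g⁻¹ ⊆ H`), and right cosets of a normal subgroup are counted by the index — the group theory behind «the points of `X_H` over `x`
are the double cosets `H \ Π^tp_X / D_x`» when `x` splits completely. [cite: MochizukiSemiAnbd2006, §6 p.71] -/
theorem card_doubleCosetQuotient_of_le_normal (H K : Subgroup G) [hH : H.Normal] (hKH : K ≤ H) :
    Nat.card (DoubleCoset.Quotient (H : Set G) (K : Set G)) = H.index := by
  -- the double-coset relation IS the right-coset relation of `H`
  have hrel : ∀ a b : G, DoubleCoset.setoid (H : Set G) (K : Set G) a b ↔ QuotientGroup.rightRel H a b := by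
    intro a b
    rw [DoubleCoset.rel_iff, QuotientGroup.rightRel_apply]
    constructor
    · rintro ⟨h, hh, k, hk, rfl⟩
      -- `h a k a⁻¹ = h · (a k a⁻¹) ∈ H`
      have : h * a * k * a⁻¹ = h * (a * k * a⁻¹) := by group
      rw [this]
      exact H.mul_mem hh (hH.conj_mem k (hKH hk) a)
    · intro hba
      exact ⟨b * a⁻¹, hba, 1, K.one_mem, by group⟩
  have e : DoubleCoset.Quotient (H : Set G) (K : Set G) ≃ _root_.Quotient (QuotientGroup.rightRel H) :=
    Quotient.congrRight hrel
  rw [Nat.card_congr (e.trans (QuotientGroup.quotientRightRelEquivQuotientLeftRel H)), Subgroup.index_eq_card]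

end Subgroup

/-! ### The fibre of `X_H → X` over a completely split point -/

namespace Literature.AnabelianGeometry.SemiGraphs.TemperedCurve

variable {p : ℕ} [Fact p.Prime] (X : TemperedCurve p) (H : Subgroup X.PiTemp)

/-- **[SemiAnbd] §6 p.71 / classical covering theory**: the points of `X_H` over a point `x` of `X` are the double cosets `H \ Π^temp_X / D_x` (abc-iut-L6-t7's
`PtOfOpen = Σ x, H \ Π^temp_X / D_x`); if `D_x ≤ H` and `H ⊴ Π^temp_X`, there are EXACTLY `[Π^temp_X : H]` of them (`x` splits completely in `X_H → X`).
PROVED. [cite: MochizukiSemiAnbd2006, §6 p.71] -/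
theorem card_fibre_ptOfOpen_of_decomp_le [H.Normal] (x : X.Pt) (hx : X.decomp x ≤ H) :
    Nat.card (DoubleCoset.Quotient (H : Set X.PiTemp) (X.decomp x : Set X.PiTemp)) = H.index :=
  Subgroup.card_doubleCosetQuotient_of_le_normal H (X.decomp x) hx

/-- The fibre of `PtOfOpen` over `x` IS the double coset space (definitional bookkeeping of the `Σ`-type). [cite: MochizukiSemiAnbd2006, §6 p.71] -/
theorem card_ptOfOpen_fibre_eq (x : X.Pt) :
    Nat.card {y : X.PtOfOpen H // y.1 = x} = Nat.card (DoubleCoset.Quotient (H : Set X.PiTemp) (X.decomp x : Set X.PiTemp)) := by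
  refine Nat.card_congr ?_
  exact
    { toFun := fun y => y.2 ▸ y.1.2
      invFun := fun q => ⟨⟨x, q⟩, rfl⟩
      left_inv := by
        rintro ⟨⟨x', q⟩, rfl⟩
        rfl
      right_inv := fun q => rfl }

end Literature.AnabelianGeometry.SemiGraphs.TemperedCurve

/-! ### [EtTh]: the cusp of `X` splits into `l` cusps of `X̲` -/

namespace Literature.AnabelianGeometry.EtaleTheta.ThetaSetting

variable {p : ℕ} [Fact p.Prime] (D : ThetaSetting p)

/-- **[EtTh] Def 2.5 (i) / §1 p.13: over every cusp `x` of `X`, the degree-`l` covering `X̲ → X` (`Π^tp_{X̲} = toZ⁻¹(l·Z)`) has EXACTLY `l` points** — since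
`D_x ⊆ Π^tp_Y = Ker(toZ) ⊆ Π^tp_{X̲}` (SettingBridge parameter (P3) `decomp_le_ker_toZ`, BY NAME; `GtpY_le_GtpXu`) and `[Π^tp_X : Π^tp_{X̲}] = l` (`index_GtpXu`): the
fibre `Π^tp_{X̲} \ Π^tp_X / D_x` of abc-iut-L6-t7's `PtOfOpen (GtpXu l)` over `x` has `l` elements.  PROVED. [cite: MochizukiEtTh2009, Def 2.5 (i) p.39] -/
theorem card_cusps_over_eq_l (l : ℕ) (e : D.OncePuncturedData) (x : D.Pt) (hx : D.IsCusp x) :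
    Nat.card {y : D.toTemperedCurve.PtOfOpen (D.GtpXu l) // y.1 = x} = l := by
  rw [D.toTemperedCurve.card_ptOfOpen_fibre_eq,
    D.toTemperedCurve.card_fibre_ptOfOpen_of_decomp_le (D.GtpXu l) x
      ((e.decomp_le_ker_toZ x hx).trans (D.GtpY_le_GtpXu l)),
    D.index_GtpXu]

end Literature.AnabelianGeometry.EtaleTheta.ThetaSetting
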